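import Mathlib
import HarnessLib
import Summits.Langlands.Langlands.Theses.RamifiedCoefficientSeed
import Literature.NumberTheory.GaloisRepresentations.CrystallineOrdinaryShape

/-!
# Line `ordinary-transfer` (strategist `--alt`) for crux stmt-Langlands-16778
`Summit.Langlands.Langlands.Theses.RamifiedCoefficientSeed.ExplicitRamifiedFamily`

Route `route-Langlands-RamifiedCoefficientSeed` (rev 3; `closes (h1 : ExplicitRamifiedFamily)
(h2 : AdjointSeedFromDuality) (h3 : AdjointLiftingGL3) (h4 : SectorComplement) : Langlands`; this crux
is `h1`).  Registered ALONGSIDE `Lines/birth.lean` (never overwriting it).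

## Why a second line: the STUCK goal of `birth` is formal, not mathematical

`birth`'s open core `stub_certifiedSeedFamily` carries the crux's conjunct (C) verbatim:
`(fontainePstAdicCompletion v p hv).IsCrystallineFramed ((f n).toLocal v) ∧ labelled HT weights = {0,1,2}`.
`IsCrystallineFramed 𝔇 ρ := 𝔇.IsDeRhamFramed ρ ∧ ∃ r, 𝔇.IsWeilDeligneOf ρ r ∧ r.N = 0 ∧ unramified r.ρ`
(`CrystallineDeformationRing.lean`), and `fontainePstAdicCompletion` is Hilbert's `ε` over Fontaine's
clauses (`FontaineDpst.lean`): its period ring is `B_dR` BY CONSTRUCTION (so the de Rham half and the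
labelled weights are genuine), but its relation `IsWeilDeligneOf` is pinned only by the structure axioms
of `PstWeilDeligneData` and — under the NAMED FACT `FontaineDatumExists` — clauses (F1)–(F11), none of
which constrains `IsWeilDeligneOf` on a representation RAMIFIED at `p` ((F8) is the unramified case).
The only unconditional producer of `IsCrystallineFramed` in the tree is
`PstWeilDeligneData.isCrystallineFramed_of_isLocallyUnramified`; a member of the family has labelled
weights `{0,1,2}`, hence is ramified at `p`.  So (C) is UNDERIVABLE AND IRREFUTABLE for every candidate
`ρ` until definition item `defn-FontainePstWeilDeligneData` (iii) = D2 "construct `WD ∘ D_pst`" lands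
(refuter notes rreview 2026-08-16T21:18Z, rattack 2026-08-17T06:57Z on the item; re-verified by this
seat by reading the three Literature files).  No line can dodge this; this line ISOLATES it.

## The cut (4 stubs, all load-bearing)

* `stub_ordinaryCertifiedFamily` (the open core, L/XL — the crux with (C) replaced by the HONEST,
  datum-free local condition ORD-GEN(0,1,2): in some frame `ρ|Γ_{ℚ_p}` is upper triangular, inertia acts
  on the diagonal through `ε⁰, ε⁻¹, ε⁻²` (the tree's `FramedRep.IsCrystallineOrdinaryOfShape` with shape
  `(0,1,2)`, inlined), and the three unramified diagonal characters `ψ_i = M_{ii}·εⁱ` are pairwise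
  distinct; and, as in `birth`, the two universal negations replaced by one-element certificates).
  This statement is DECIDED in every model of the tree (no `ε`-term), is what point counts certify for a
  geometric family with good ORDINARY reduction at `p` (unit-root condition), and is REFUTABLE in
  principle — unlike the crux.  It remains blocked in Lean by the absence of any constructor of `H²_ét`
  (or of `r_ι(π)` for `GL₃`) as a `FramedGaloisRep` (a second, independent infrastructure debt), but it is
  attackable on paper / by `kit`, which is what the route's compute seat does anyway.
* `stub_pinnedCrystalline_of_ordinaryGeneric` (the TRANSFER = the missing comparison clause, universal
  in `ρ`): ORD-GEN(0,1,2) at `v ∣ p` ⇒ pinned-crystalline with labelled weights `{0,1,2}`.  TRUE for the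
  genuine datum: a Greenberg-ordinary representation is semi-stable (Perrin-Riou 1994; for a strictly
  increasing shape the tree's notion IS Greenberg's, `isGreenbergOrdinaryOfShape_iff_of_injective`), so
  `D_st` is filtered by the flag with `φ`-eigenvalues `λ_i = u_i pⁱ` (`u_i = ψ_i(Frob)^{±1}` units); `N`
  maps the `λ`-eigenline to the `λ/p`-eigenline, and `λ_i / p = λ_j` forces `j = i - 1` and `u_i = u_j`,
  excluded by genericity — so `N = 0`, `ρ` is crystalline, `WD(D_pst ρ)` is unramified with `N = 0`, and
  the weights are `{0,1,2}` (tree convention `HT(ε) = -1`).  UNPROVABLE before D2 (conclusion mentions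
  the pinned `IsWeilDeligneOf`); after D2 it is Perrin-Riou's theorem + `φ`-eigenvalue bookkeeping.  It is
  EXACTLY the Upgrade-path clause the crux needs, stated once, reusable by every positive-position
  crystalline clause on the summit.  DO NOT STAFF before `defn-FontainePstWeilDeligneData` (iii) lands
  (`workitem block … --reason upstream:defn-FontainePstWeilDeligneData`).
* `stub_not_twistEquivalent_of_certificate`, `stub_not_essSelfDual_of_certificate` — `birth`'s two
  certificate lemmas, same statements (provable now, M-sized; Newton's identities for `3 × 3` matrices).
* `ExplicitRamifiedFamily_of : stub₁ → stub₂ → stub₃ → stub₄ → ExplicitRamifiedFamily` — kernel-checked,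
  no `sorry`, pure logic; all four hypotheses used.

Transfer (C⁺ and why easier): C⁺ = `stub_ordinaryCertifiedFamily`.  Neither C⁺ ⇒ C nor C ⇒ C⁺ is
formal (C⁺ ⇒ C is stub 2; C ⇏ C⁺ since crystalline ⇏ ordinary).  C⁺ is EASIER in the precise sense
that it is decidable in the tree's semantics, certifiable by a finite computation on the intended
geometric source (ordinarity = `p`-adic unit root of the Frobenius polynomial at `p`; shape from Hodge
numbers (1,1,1)), and matches the ORDINARY lifting theorem ACCGHLNSTT2023 Thm 6.1.2 (`p > n = 3`), the
branch the route header already names as its pivot.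

Disproof used: none exists for this crux (`ledger crux ls`: no `Disproof.lean`, no `Negative/`, no dead
line; negatives index 4 entries, none of this shape).  Honoured in advance: the landed Negative lemmas of
`Theorems/ReciprocityUpToIrreducibility/Negative/FontaineSpecUnramifiedTwist.lean` (unramified-twist
models of the datum) show the KIND of model-multiplicity that makes (C) undecidable; stub 2 is the clause
that would remove it, not an instance those lemmas refute (they concern unramified twists, which
preserve `IsCrystallineFramed`).
-/

set_option linter.dupNamespace false

noncomputable section

namespace Summit.Langlands.Langlands.Cruxes.ExplicitRamifiedFamily.OrdinaryTransfer

open Summit.Langlands.Langlands.Theses.RamifiedCoefficientSeed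
open Literature.NumberTheory.GaloisRepresentations
open Filter IsDedekindDomain
open scoped NumberField MatrixGroups

/-! ## 1. The four stubs -/

/-- **STUB 1 — the ORDINARY-GENERIC certified family** (open core; explicit AG + arithmetic; blocked in
Lean only by the missing `H²_ét` / `r_ι(π)` constructor, NOT by the pinned datum).  There are a prime
`p ≥ 11` and `f : ℕ → (Γ_ℚ → GL₃(ℚ̄_p))` with: (pairs) one-element twist-inequivalence certificates;
(members) a one-element non-self-duality certificate; unramified a.e.; ORD-GEN(0,1,2) at every `v ∣ p`
(triangular frame, inertial diagonal `ε⁰, ε⁻¹, ε⁻²`, pairwise distinct unramified parts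
`M_{ii}·εⁱ`); residual essential self-duality in trace form; `ρ̄|ℚ(ζ_p)` absolutely irreducible; a
complex conjugation of trace `±1`.  Intended source: `λ`-adic (1,1,1)-eigenpieces of `H²` of surfaces
over `ℚ` with a `ℚ`-RATIONAL automorphism of order `p^k` and good ORDINARY reduction at `p`.
Why it might fail: Hodge/eigenspace numerology (`p_g = φ(p^k) ≥ 10` with multiplicity one,
transcendental `E`-rank exactly 3) plus `ℚ`-rationality (an order-11 element of `PGL_{N+1}(ℚ)` needs
`N ≥ 9`: no double planes, no surfaces in `ℙ³`), plus ordinarity at `p` of a surface with `p_g ≥ 10`.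
[cite: VangeemenTop1994, §1 (the order-4 construction this transplants)]
[cite: Greenberg1991, §2] [cite: ACCGHLNSTT2023, Thm 6.1.2] -/
theorem stub_ordinaryCertifiedFamily :
    ∃ (p : ℕ) (_ : Fact p.Prime), 11 ≤ p ∧
      ∃ f : ℕ → Literature.NumberTheory.GaloisRepresentations.FramedGaloisRep ℚ (PadicAlgCl p) 3,
        (∀ m n, m ≠ n → ∃ σ : Field.absoluteGaloisGroup ℚ,
            (f m σ).val.trace ^ 3 * (f n σ).val.det ≠ (f n σ).val.trace ^ 3 * (f m σ).val.det) ∧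
        ∀ n,
          (∃ σ : Field.absoluteGaloisGroup ℚ,
              ((f n σ).val.trace ^ 2 - ((f n σ).val ^ 2).trace) ^ 3 ≠
                8 * (f n σ).val.trace ^ 3 * (f n σ).val.det) ∧
          (∀ᶠ v : IsDedekindDomain.HeightOneSpectrum (NumberField.RingOfIntegers ℚ) in Filter.cofinite,
              (f n).IsUnramifiedAt v) ∧
          (∀ (v : IsDedekindDomain.HeightOneSpectrum (NumberField.RingOfIntegers ℚ))
              (_hv : ((p : ℕ) : NumberField.RingOfIntegers ℚ) ∈ v.asIdeal),
              ∃ g : GL (Fin 3) (PadicAlgCl p),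
                (∀ (τ : Field.absoluteGaloisGroup (v.adicCompletion ℚ)) (i j : Fin 3), j < i →
                    ((g * (f n).toLocal v τ * g⁻¹ : GL (Fin 3) (PadicAlgCl p)) :
                      Matrix (Fin 3) (Fin 3) (PadicAlgCl p)) i j = 0) ∧
                (∀ τ ∈ absInertia (v.adicCompletion ℚ), ∀ i : Fin 3,
                    ((g * (f n).toLocal v τ * g⁻¹ : GL (Fin 3) (PadicAlgCl p)) :
                      Matrix (Fin 3) (Fin 3) (PadicAlgCl p)) i i =
                      algebraMap ℚ_[p] (PadicAlgCl p)
                        ((((GaloisRep.cyclotomicCharacter (v.adicCompletion ℚ) p τ)⁻¹ : ℤ_[p]ˣ) :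
                          ℤ_[p]) : ℚ_[p]) ^ (i : ℕ)) ∧
                (∀ i j : Fin 3, i ≠ j → ∃ τ : Field.absoluteGaloisGroup (v.adicCompletion ℚ),
                    ((g * (f n).toLocal v τ * g⁻¹ : GL (Fin 3) (PadicAlgCl p)) :
                      Matrix (Fin 3) (Fin 3) (PadicAlgCl p)) i i *
                        algebraMap ℚ_[p] (PadicAlgCl p)
                          ((((GaloisRep.cyclotomicCharacter (v.adicCompletion ℚ) p τ) : ℤ_[p]ˣ) :
                            ℤ_[p]) : ℚ_[p]) ^ (i : ℕ) ≠
                    ((g * (f n).toLocal v τ * g⁻¹ : GL (Fin 3) (PadicAlgCl p)) :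
                      Matrix (Fin 3) (Fin 3) (PadicAlgCl p)) j j *
                        algebraMap ℚ_[p] (PadicAlgCl p)
                          ((((GaloisRep.cyclotomicCharacter (v.adicCompletion ℚ) p τ) : ℤ_[p]ˣ) :
                            ℤ_[p]) : ℚ_[p]) ^ (j : ℕ))) ∧
          (∃ ν : Literature.NumberTheory.GaloisRepresentations.FramedGaloisRep ℚ (PadicAlgCl p) 1,
              ∀ σ, ‖(f n σ).val.trace - (ν σ).val 0 0 * (f n σ⁻¹).val.trace‖ < 1) ∧
          ((f n).restrictField (CyclotomicField p ℚ)).IsResiduallyAbsIrreducible ∧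
          (∃ (φ : ℚ →+* ℝ) (c : Field.absoluteGaloisGroup ℚ),
              Literature.NumberTheory.GaloisRepresentations.IsComplexConjugation φ c ∧
                (((f n) c).val.trace = 1 ∨ ((f n) c).val.trace = -1)) := by
  sorry

/-- **STUB 2 — TRANSFER: ordinary-generic of shape `(0,1,2)` at `v ∣ p` is pinned-crystalline with
labelled Hodge–Tate weights `{0,1,2}`** (the comparison clause; universal in `ρ`).  True for Fontaine's
datum: Greenberg-ordinary ⇒ semi-stable (Perrin-Riou), `N` lowers `φ`-slopes by one and the unit parts
`u_i` of the `φ`-eigenvalues `u_i pⁱ` on the graded pieces are pairwise distinct by hypothesis, so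
`N = 0`: crystalline, `WD(D_pst ρ) = (D_cris, N = 0)` unramified; weights `{0,1,2}` since `HT(ε) = -1`.
UNPROVABLE in the tree before D2 (`defn-FontainePstWeilDeligneData` (iii)): the conclusion's
`IsWeilDeligneOf` half is pinned by specification only.  Do not staff before D2.
[cite: PerrinRiou1994Ordinaires, Exposé IV (ordinary ⇒ semi-stable; description of D_st)]
[cite: FontaineAsterisque223VIII, §1.3 and §2.3.7] [cite: Greenberg1991, §2] -/
theorem stub_pinnedCrystalline_of_ordinaryGeneric :
    ∀ (p : ℕ) [Fact p.Prime]
      (ρ : Literature.NumberTheory.GaloisRepresentations.FramedGaloisRep ℚ (PadicAlgCl p) 3)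
      (v : IsDedekindDomain.HeightOneSpectrum (NumberField.RingOfIntegers ℚ))
      (hv : ((p : ℕ) : NumberField.RingOfIntegers ℚ) ∈ v.asIdeal),
      (∃ g : GL (Fin 3) (PadicAlgCl p),
          (∀ (τ : Field.absoluteGaloisGroup (v.adicCompletion ℚ)) (i j : Fin 3), j < i →
              ((g * ρ.toLocal v τ * g⁻¹ : GL (Fin 3) (PadicAlgCl p)) :
                Matrix (Fin 3) (Fin 3) (PadicAlgCl p)) i j = 0) ∧
          (∀ τ ∈ absInertia (v.adicCompletion ℚ), ∀ i : Fin 3,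
              ((g * ρ.toLocal v τ * g⁻¹ : GL (Fin 3) (PadicAlgCl p)) :
                Matrix (Fin 3) (Fin 3) (PadicAlgCl p)) i i =
                algebraMap ℚ_[p] (PadicAlgCl p)
                  ((((GaloisRep.cyclotomicCharacter (v.adicCompletion ℚ) p τ)⁻¹ : ℤ_[p]ˣ) :
                    ℤ_[p]) : ℚ_[p]) ^ (i : ℕ)) ∧
          (∀ i j : Fin 3, i ≠ j → ∃ τ : Field.absoluteGaloisGroup (v.adicCompletion ℚ),
              ((g * ρ.toLocal v τ * g⁻¹ : GL (Fin 3) (PadicAlgCl p)) :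
                Matrix (Fin 3) (Fin 3) (PadicAlgCl p)) i i *
                  algebraMap ℚ_[p] (PadicAlgCl p)
                    ((((GaloisRep.cyclotomicCharacter (v.adicCompletion ℚ) p τ) : ℤ_[p]ˣ) :
                      ℤ_[p]) : ℚ_[p]) ^ (i : ℕ) ≠
              ((g * ρ.toLocal v τ * g⁻¹ : GL (Fin 3) (PadicAlgCl p)) :
                Matrix (Fin 3) (Fin 3) (PadicAlgCl p)) j j *
                  algebraMap ℚ_[p] (PadicAlgCl p)
                    ((((GaloisRep.cyclotomicCharacter (v.adicCompletion ℚ) p τ) : ℤ_[p]ˣ) :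
                      ℤ_[p]) : ℚ_[p]) ^ (j : ℕ))) →
      let D := Literature.NumberTheory.PAdicHodge.fontainePstAdicCompletion v p hv
      D.IsCrystallineFramed (ρ.toLocal v) ∧
        (letI := D.algebra
         ∀ τ : v.adicCompletion ℚ →ₐ[ℚ_[p]] PadicAlgCl p,
           ρ.labelledHodgeTateWeightsAt v D.algebra D.𝔅 τ.toRingHom = {0, 1, 2}) := by
  sorry

/-- **STUB 3 — one violating element certifies twist-inequivalence** (as in `Lines/birth.lean`;
provable now: Newton's identities for `3 × 3` matrices in characteristic `0`). [folklore] -/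
theorem stub_not_twistEquivalent_of_certificate :
    ∀ (p : ℕ) [Fact p.Prime] (K : Type) [Field K]
      (ρ ρ' : Literature.NumberTheory.GaloisRepresentations.FramedGaloisRep K (PadicAlgCl p) 3),
      (∃ σ : Field.absoluteGaloisGroup K,
          (ρ σ).val.trace ^ 3 * (ρ' σ).val.det ≠ (ρ' σ).val.trace ^ 3 * (ρ σ).val.det) →
      ¬ ∃ χ : Literature.NumberTheory.GaloisRepresentations.FramedGaloisRep K (PadicAlgCl p) 1,
          ∀ σ, (ρ σ).val.trace = (χ σ).val 0 0 * (ρ' σ).val.trace := by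
  sorry

/-- **STUB 4 — one violating element certifies NON-essential-self-duality** (as in
`Lines/birth.lean`; provable now). [folklore] -/
theorem stub_not_essSelfDual_of_certificate :
    ∀ (p : ℕ) [Fact p.Prime] (K : Type) [Field K]
      (ρ : Literature.NumberTheory.GaloisRepresentations.FramedGaloisRep K (PadicAlgCl p) 3),
      (∃ σ : Field.absoluteGaloisGroup K,
          ((ρ σ).val.trace ^ 2 - ((ρ σ).val ^ 2).trace) ^ 3 ≠
            8 * (ρ σ).val.trace ^ 3 * (ρ σ).val.det) →
      ¬ ∃ χ : Literature.NumberTheory.GaloisRepresentations.FramedGaloisRep K (PadicAlgCl p) 1,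
          ∀ σ, (ρ σ⁻¹).val.trace = (χ σ).val 0 0 * (ρ σ).val.trace := by
  sorry

/-! ## 2. The stub statements as named propositions -/

namespace _Goal

/-- The statement of `stub_ordinaryCertifiedFamily` (literally its type). [folklore] -/
def stub_ordinaryCertifiedFamily : Prop :=
  type_of% @Summit.Langlands.Langlands.Cruxes.ExplicitRamifiedFamily.OrdinaryTransfer.stub_ordinaryCertifiedFamily

/-- The statement of `stub_pinnedCrystalline_of_ordinaryGeneric` (literally its type). [folklore] -/
def stub_pinnedCrystalline_of_ordinaryGeneric : Prop :=
  type_of% @Summit.Langlands.Langlands.Cruxes.ExplicitRamifiedFamily.OrdinaryTransfer.stub_pinnedCrystalline_of_ordinaryGeneric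

/-- The statement of `stub_not_twistEquivalent_of_certificate` (literally its type). [folklore] -/
def stub_not_twistEquivalent_of_certificate : Prop :=
  type_of% @Summit.Langlands.Langlands.Cruxes.ExplicitRamifiedFamily.OrdinaryTransfer.stub_not_twistEquivalent_of_certificate

/-- The statement of `stub_not_essSelfDual_of_certificate` (literally its type). [folklore] -/
def stub_not_essSelfDual_of_certificate : Prop :=
  type_of% @Summit.Langlands.Langlands.Cruxes.ExplicitRamifiedFamily.OrdinaryTransfer.stub_not_essSelfDual_of_certificate

end _Goal

/-! ## 3. The composition (kernel-checked, no `sorry`) -/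

/-- **`ExplicitRamifiedFamily` from the four stubs.**  Unpack the ordinary-generic certified family
(STUB 1); pairs: feed each certificate to STUB 3; members: feed the non-self-duality certificate to
STUB 4 and the ORD-GEN(0,1,2) datum at each `v ∣ p` to the transfer STUB 2, which returns exactly the
crux's pinned-crystalline-with-weights clause; pass the remaining conjuncts through verbatim.  The
conclusion is the route decl, by name. [folklore] -/
theorem ExplicitRamifiedFamily_of (h₁ : _Goal.stub_ordinaryCertifiedFamily)
    (h₂ : _Goal.stub_pinnedCrystalline_of_ordinaryGeneric)
    (h₃ : _Goal.stub_not_twistEquivalent_of_certificate)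
    (h₄ : _Goal.stub_not_essSelfDual_of_certificate) :
    Summit.Langlands.Langlands.Theses.RamifiedCoefficientSeed.ExplicitRamifiedFamily := by
  unfold _Goal.stub_ordinaryCertifiedFamily at h₁
  unfold _Goal.stub_pinnedCrystalline_of_ordinaryGeneric at h₂
  unfold _Goal.stub_not_twistEquivalent_of_certificate at h₃
  unfold _Goal.stub_not_essSelfDual_of_certificate at h₄
  obtain ⟨p, hp, h11, f, hpairs, hf⟩ := h₁
  refine ⟨p, hp, h11, f, ?_, ?_⟩
  · intro m n hmn
    exact h₃ p ℚ (f m) (f n) (hpairs m n hmn)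
  · intro n
    obtain ⟨hcert, hunr, hord, hdual, hirr, hcc⟩ := hf n
    exact ⟨h₄ p ℚ (f n) hcert, hunr, fun v hv => h₂ p (f n) v hv (hord v hv), hdual, hirr, hcc⟩

/-- By-name sanity check: the four stubs feed the composition as they stand. -/
example : Summit.Langlands.Langlands.Theses.RamifiedCoefficientSeed.ExplicitRamifiedFamily :=
  ExplicitRamifiedFamily_of stub_ordinaryCertifiedFamily stub_pinnedCrystalline_of_ordinaryGeneric
    stub_not_twistEquivalent_of_certificate stub_not_essSelfDual_of_certificate

end Summit.Langlands.Langlands.Cruxes.ExplicitRamifiedFamily.OrdinaryTransfer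

end
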